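import Mathlib
import Summits.Ventures.PercRepro2.PMK5Deg3Kernel
import Summits.Ventures.PercRepro2.Deg3Conn
import Summits.Ventures.PercRepro2.Deg3Kron
import Summits.Ventures.PercRepro2.Deg3Digits
import Summits.Ventures.PercRepro2.Deg3Tables
import Summits.Ventures.PercRepro2.Deg3Bits
import Summits.Ventures.PercRepro2.Deg3Slices

/-!
# THEOREM 28 — ROW 2′TRI AND (HCOV) ON EVERY `K₅ + {a₃x, a₃y, a₃z}` WITH SLICE CERTIFICATES: THE DEGREE-3 FAMILY
(blind cell PercRepro2, mine-2 g27; mine-2 g26's `Deg2Typed.lean` (typer-1's `K5TypedK3.lean`) on the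
thirteen-edge skeletons, parametrised by the attachment triple `(x, y, z)`, with the certificate SLICED along
the two `a₃`-edges `11`, `12` (`PMK5Deg3Kernel.lean`, `Deg3Slices.lean`); census M2-63, kit j260972, two own codes)

By `Deg3Tables.K3_apply`, on `K₅ + {a₃x, a₃y, a₃z}` with the marks `(o, a₁, a₂, a₃, b) = (0, 1, 2, 5, 4)` the
kernel `K₃ a b c` is a signed sum of twenty products of tables, so a typed count `typedCount F w₀ τ K₃` is the
signed triple count of the profile `k` of the minor `(F, w₀, τ)` (`typedCount_K3_eq`: `cntPos13 k − cntNeg13 k`).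
The slice decomposition `Deg3Slices.cntPos13_eq` / `cntNeg13_eq` writes these as the slice counts at the two last
digits of `k`, and a slice certificate `CertS x y z j₁ j₂` (one `decide +kernel` per slice, sixteen per triple)
bounds `cntNegS ≤ cntPosS` there (`Deg3Slices.cntNegS_le_cntPosS`), hence

* **`cntNeg13_le_cntPos13`**: `Cert x y z → ∀ k, cntNeg13 x y z k ≤ cntPos13 x y z k`;
* **`typedCount_K3_nonneg`**: every weight-free typed count of `K₃` on the thirteen-edge graph is `≥ 0` —
  all minors `(F, w₀)`, all type maps;
* **`typedBases`**: `Cert x y z → CovForm.TypedBases (ends13 x y z) 0 1 2 5 4` — row 2′TRI on `K₅ + {a₃x, a₃y, a₃z}`;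
* **`HCov_deg3`**: `Cert x y z → CovForm.HCov p (ends13 x y z) 0 1 2 5 4` for every probability vector
  `p : Fin 13 → R` — (HCOV) on every instance of the family (the ten base edges and the three `a₃`-edges at any
  weights, missing edges at weight `0`), by `CovForm.HCov_of_typedBases`.
-/

namespace Summit.Ventures.PercRepro2

open Hub

namespace Deg3

/-! ## The tables of the family, by index -/

/-- The table `0` of `tab`. -/
lemma tab0 (x y z : Fin 5) : tab x y z 0 = tQ x y z := rfl
/-- The table `1` of `tab`. -/
lemma tab1 (x y z : Fin 5) : tab x y z 1 = tPD x y z := rfl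
/-- The table `2` of `tab`. -/
lemma tab2 (x y z : Fin 5) : tab x y z 2 = tPDoU x y z := rfl
/-- The table `3` of `tab`. -/
lemma tab3 (x y z : Fin 5) : tab x y z 3 = t4p x y z := rfl
/-- The table `4` of `tab`. -/
lemma tab4 (x y z : Fin 5) : tab x y z 4 = t4m x y z := rfl
/-- The table `5` of `tab`. -/
lemma tab5 (x y z : Fin 5) : tab x y z 5 = t5p x y z := rfl
/-- The table `6` of `tab`. -/
lemma tab6 (x y z : Fin 5) : tab x y z 6 = t5m x y z := rfl
/-- The table `7` of `tab`. -/
lemma tab7 (x y z : Fin 5) : tab x y z 7 = t6p x y z := rfl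
/-- The table `8` of `tab`. -/
lemma tab8 (x y z : Fin 5) : tab x y z 8 = t6m x y z := rfl
/-- The table `9` of `tab`. -/
lemma tab9 (x y z : Fin 5) : tab x y z 9 = t7p x y z 4 := rfl
/-- The table `10` of `tab`. -/
lemma tab10 (x y z : Fin 5) : tab x y z 10 = t7m x y z 4 := rfl
/-- The table `11` of `tab`. -/
lemma tab11 (x y z : Fin 5) : tab x y z 11 = t7p x y z 0 := rfl
/-- The table `12` of `tab`. -/
lemma tab12 (x y z : Fin 5) : tab x y z 12 = t7m x y z 0 := rfl
/-- The table `13` of `tab`. -/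
lemma tab13 (x y z : Fin 5) : tab x y z 13 = t7p x y z 5 := rfl
/-- The table `14` of `tab`. -/
lemma tab14 (x y z : Fin 5) : tab x y z 14 = t7m x y z 5 := rfl
/-- The table `15` of `tab`. -/
lemma tab15 (x y z : Fin 5) : tab x y z 15 = t10p x y z := rfl
/-- The table `16` of `tab`. -/
lemma tab16 (x y z : Fin 5) : tab x y z 16 = t10m x y z := rfl
/-- The table `17` of `tab`. -/
lemma tab17 (x y z : Fin 5) : tab x y z 17 = t11 x y z := rfl
/-- The table `18` of `tab`. -/
lemma tab18 (x y z : Fin 5) : tab x y z 18 = t12 x y z := rfl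

/-! ## Typed counts are signed triple counts -/

section Counts

variable {R : Type*} [Field R] (x y z : Fin 5)

/-- The profile of a minor `(F, w₀)` with types `τ ≤ 3` on `F`: `τ` on `F`, `3 · w₀` off `F`. -/
lemma exists_profile (F : Finset (Fin 13)) (w₀ : Config (Fin 13)) (τ : Fin 13 → ℕ)
    (hτ : ∀ e ∈ F, τ e ≤ 3) :
    ∃ k : Fin 13 → Fin 4, ∀ e, (k e : ℕ) = if e ∈ F then τ e else if w₀ e then 3 else 0 := by
  refine ⟨fun e => if he : e ∈ F then ⟨τ e, Nat.lt_succ_of_le (hτ e he)⟩ else if w₀ e then 3 else 0,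
    fun e => ?_⟩
  by_cases he : e ∈ F
  · simp [he]
  · simp only [dif_neg he, if_neg he]
    cases w₀ e <;> rfl

/-- The constraint of a typed count is the profile constraint `prof x y w = k`. -/
lemma typed_constraint_iff (F : Finset (Fin 13)) (w₀ : Config (Fin 13)) (τ : Fin 13 → ℕ)
    (k : Fin 13 → Fin 4) (hk : ∀ e, (k e : ℕ) = if e ∈ F then τ e else if w₀ e then 3 else 0)
    (x y w : Config (Fin 13)) :
    ((∀ e, e ∉ F → x e = w₀ e ∧ y e = w₀ e ∧ w e = w₀ e) ∧ (∀ e ∈ F, openCount x y w e = τ e)) ↔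
      prof x y w = k := by
  constructor
  · rintro ⟨h1, h2⟩
    funext e
    apply Fin.ext
    rw [hk e]
    by_cases he : e ∈ F
    · rw [if_pos he]
      exact h2 e he
    · rw [if_neg he]
      obtain ⟨hx, hy, hw⟩ := h1 e he
      simp only [Hub.prof, hx, hy, hw]
      cases w₀ e <;> rfl
  · intro hprof
    constructor
    · intro e he
      have := congrArg (fun f => (f e : ℕ)) hprof
      simp only [Hub.prof] at this
      rw [hk e, if_neg he] at this
      revert this
      cases w₀ e <;> cases x e <;> cases y e <;> cases w e <;> intro this <;> simp at this ⊢
    · intro e he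
      have := congrArg (fun f => (f e : ℕ)) hprof
      simp only [Hub.prof] at this
      rw [hk e, if_pos he] at this
      exact this

/-- The typed count of a product of three tables is the triple count of the profile. -/
lemma typedCount_tables (F : Finset (Fin 13)) (w₀ : Config (Fin 13)) (τ : Fin 13 → ℕ)
    (k : Fin 13 → Fin 4) (hk : ∀ e, (k e : ℕ) = if e ∈ F then τ e else if w₀ e then 3 else 0)
    (T₁ T₂ T₃ : (Fin 13 → Bool) → Bool) :
    typedCount F w₀ τ (fun x y w => indR (R := R) T₁ x * indR T₂ y * indR T₃ w) =
      ((cnt3n T₁ T₂ T₃ k : ℕ) : R) := by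
  rw [← coef3_eq_cnt3n]
  unfold typedCount coef3
  simp only [typed_constraint_iff F w₀ τ k hk, Finset.sum_filter, Fintype.sum_prod_type]

/-- A typed count is linear in the kernel (sums). -/
lemma typedCount_add (F : Finset (Fin 13)) (w₀ : Config (Fin 13)) (τ : Fin 13 → ℕ)
    (K K' : Config (Fin 13) → Config (Fin 13) → Config (Fin 13) → R) :
    typedCount F w₀ τ (fun x y w => K x y w + K' x y w) = typedCount F w₀ τ K + typedCount F w₀ τ K' := by
  unfold typedCount
  simp only [← Finset.sum_add_distrib]
  refine Finset.sum_congr rfl fun x _ => Finset.sum_congr rfl fun y _ =>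
    Finset.sum_congr rfl fun w _ => ?_
  split_ifs <;> simp

/-- A typed count is linear in the kernel (differences). -/
lemma typedCount_sub (F : Finset (Fin 13)) (w₀ : Config (Fin 13)) (τ : Fin 13 → ℕ)
    (K K' : Config (Fin 13) → Config (Fin 13) → Config (Fin 13) → R) :
    typedCount F w₀ τ (fun x y w => K x y w - K' x y w) = typedCount F w₀ τ K - typedCount F w₀ τ K' := by
  unfold typedCount
  simp only [← Finset.sum_sub_distrib]
  refine Finset.sum_congr rfl fun x _ => Finset.sum_congr rfl fun y _ =>
    Finset.sum_congr rfl fun w _ => ?_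
  split_ifs <;> simp

/-- **A typed count of `K₃` on `K₅ + {a₃x, a₃y, a₃z}` is the signed triple count of its profile.** -/
lemma typedCount_K3_eq (F : Finset (Fin 13)) (w₀ : Config (Fin 13)) (τ : Fin 13 → ℕ)
    (k : Fin 13 → Fin 4) (hk : ∀ e, (k e : ℕ) = if e ∈ F then τ e else if w₀ e then 3 else 0) :
    typedCount F w₀ τ (CovForm.K3 (R := R) (ends13 x y z) 0 1 2 5 4) =
      ((cntPos13 x y z k : ℕ) : R) - ((cntNeg13 x y z k : ℕ) : R) := by
  have hK : CovForm.K3 (R := R) (ends13 x y z) 0 1 2 5 4 = fun a b c =>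
      (indR (tPD x y z) a * indR (tQ x y z) b * indR (t4p x y z) c + indR (tQ x y z) a * indR (tPDoU x y z) b * indR (t5p x y z) c +
        indR (tPD x y z) a * indR (tQ x y z) b * indR (t6m x y z) c +
        indR (tPD x y z) a * indR (t7p x y z 4) b * indR (t7m x y z 0) c + indR (tPD x y z) a * indR (t7m x y z 4) b * indR (t7p x y z 0) c +
        indR (tPDoU x y z) a * indR (t7p x y z 4) b * indR (t7m x y z 5) c + indR (tPDoU x y z) a * indR (t7m x y z 4) b * indR (t7p x y z 5) c +
        indR (tPD x y z) a * indR (t7p x y z 4) b * indR (t10p x y z) c + indR (tPD x y z) a * indR (t7m x y z 4) b * indR (t10m x y z) c +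
        indR (tQ x y z) a * indR (t12 x y z) b * indR (tPDoU x y z) c) -
      (indR (tPD x y z) a * indR (tQ x y z) b * indR (t4m x y z) c + indR (tQ x y z) a * indR (tPDoU x y z) b * indR (t5m x y z) c +
        indR (tPD x y z) a * indR (tQ x y z) b * indR (t6p x y z) c +
        indR (tPD x y z) a * indR (t7p x y z 4) b * indR (t7p x y z 0) c + indR (tPD x y z) a * indR (t7m x y z 4) b * indR (t7m x y z 0) c +
        indR (tPDoU x y z) a * indR (t7p x y z 4) b * indR (t7p x y z 5) c + indR (tPDoU x y z) a * indR (t7m x y z 4) b * indR (t7m x y z 5) c +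
        indR (tPD x y z) a * indR (t7p x y z 4) b * indR (t10m x y z) c + indR (tPD x y z) a * indR (t7m x y z 4) b * indR (t10p x y z) c +
        indR (tPD x y z) a * indR (tQ x y z) b * indR (t11 x y z) c) := by
    funext a b c
    exact K3_apply x y z a b c
  rw [hK, typedCount_sub]
  simp only [typedCount_add, typedCount_tables F w₀ τ k hk]
  simp only [cntPos13, cntNeg13, posMonos, negMonos, List.map_cons, List.map_nil, List.sum_cons,
    List.sum_nil, add_zero, tab0, tab1, tab2, tab3, tab4, tab5, tab6, tab7, tab8, tab9, tab10, tab11, tab12,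
    tab13, tab14, tab15, tab16, tab17, tab18]
  push_cast
  ring

end Counts

/-! ## The digit bridge through the slices -/

section Digits

/-- **Every typed coefficient of `K₃` on `K₅ + {a₃x, a₃y, a₃z}` is `≥ 0`** given the sixteen slice certificates
of the triple: `cntNeg13 x y z k ≤ cntPos13 x y z k`. -/
theorem cntNeg13_le_cntPos13 (x y z : Fin 5) {L : Fin 19 → Bool → Bool → ℕ} (hL : LitOK x y z L)
    (hc : Cert L) (k : Fin 13 → Fin 4) : cntNeg13 x y z k ≤ cntPos13 x y z k := by
  rw [cntPos13_eq, cntNeg13_eq]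
  exact cntNegS_le_cntPosS x y z hL (hc (k 11) (k 12)) (restr k)

end Digits

/-! ## The typed base and (HCOV) on the family -/

section Base

variable {R : Type*} [Field R] [LinearOrder R] [IsStrictOrderedRing R]

/-- **Every weight-free typed count of `K₃` on `K₅ + {a₃x, a₃y, a₃z}` is nonnegative** — all minors `(F, w₀)`,
all type maps. -/
theorem typedCount_K3_nonneg (x y z : Fin 5) {L : Fin 19 → Bool → Bool → ℕ} (hL : LitOK x y z L) (hc : Cert L)
    (F : Finset (Fin 13)) (w₀ : Config (Fin 13)) (τ : Fin 13 → ℕ) :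
    0 ≤ typedCount F w₀ τ (CovForm.K3 (R := R) (ends13 x y z) 0 1 2 5 4) := by
  by_cases hτ : ∀ e ∈ F, τ e ≤ 3
  · obtain ⟨k, hk⟩ := exists_profile F w₀ τ hτ
    rw [typedCount_K3_eq x y z F w₀ τ k hk, sub_nonneg]
    exact_mod_cast cntNeg13_le_cntPos13 x y z hL hc k
  · have : typedCount F w₀ τ (CovForm.K3 (R := R) (ends13 x y z) 0 1 2 5 4) = 0 := by
      unfold typedCount
      refine Finset.sum_eq_zero fun x _ => Finset.sum_eq_zero fun y _ =>
        Finset.sum_eq_zero fun w _ => ?_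
      rw [if_neg]
      rintro ⟨-, h2⟩
      apply hτ
      intro e he
      rw [← h2 e he]
      unfold openCount
      have := Bool.toNat_le (x e)
      have := Bool.toNat_le (y e)
      have := Bool.toNat_le (w e)
      omega
    rw [this]

/-- **THEOREM 28 (typed form): row 2′TRI on `K₅ + {a₃x, a₃y, a₃z}`** given the triple's slice certificates —
`CovForm.TypedBases (ends13 x y z) 0 1 2 5 4`. -/
theorem typedBases (x y z : Fin 5) {L : Fin 19 → Bool → Bool → ℕ} (hL : LitOK x y z L) (hc : Cert L) :
    CovForm.TypedBases (R := R) (ends13 x y z) 0 1 2 5 4 :=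
  fun F w₀ τ _ => typedCount_K3_nonneg x y z hL hc F w₀ τ

/-- **THEOREM 28: (HCOV) on every `K₅ + {a₃x, a₃y, a₃z}` instance** given the triple's slice certificates —
`CovForm.HCov p (ends13 x y z) 0 1 2 5 4` for every probability vector `p : Fin 13 → R` (every weight vector,
missing edges at weight `0`). -/
theorem HCov_deg3 (x y z : Fin 5) {L : Fin 19 → Bool → Bool → ℕ} (hL : LitOK x y z L) (hc : Cert L)
    (p : Fin 13 → R) (hp : IsProbVec p) : CovForm.HCov p (ends13 x y z) 0 1 2 5 4 :=
  CovForm.HCov_of_typedBases (ends13 x y z) 0 1 2 5 4 (typedBases x y z hL hc) p hp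

end Base

end Deg3

end Summit.Ventures.PercRepro2
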